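import Mathlib.NumberTheory.LSeries.PrimesInAP
import Mathlib.NumberTheory.PrimeCounting
import Mathlib.Data.Nat.Totient
import Mathlib.Analysis.Asymptotics.Defs
import Mathlib.Analysis.SpecialFunctions.Pow.Real
import HarnessLib

-- provenance: harness21/H21/H21/Prelude/AntSieve/LevelOfDistribution.lean @ 92cfc90 (interim HEAD d8f2665); M5 mechanical rewrite
/-!
# Level of distribution, Bombieri–Vinogradov / Elliott–Halberstam shapes, sifted sequences

Trunk `AntSieve`, item C12 (`level_of_distribution`; OUTLINE D-SIEVE-5).

## Prime layer

* `chebyshevPsiMod q a x = ψ(x; q, a) = ∑_{n ≤ x, n ≡ a (q)} Λ(n)` and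
  `primeCountingMod q a x = π(x; q, a)`; the bodies are byte-identical to the accepted glue in
  `Literature.Statements.Parity.Wave0` (which this prelude file must not import), built on Mathlib's
  `ArithmeticFunction.vonMangoldt.residueClass` (`Mathlib.NumberTheory.LSeries.PrimesInAP`).
* `primeAPError x q = E*(x; q) = max_{1 ≤ y ≤ x} max_{(a,q)=1} |ψ(y; q, a) − y/φ(q)|`, written as the
  double `iSup` of Wave0's `bombieri_vinogradov` (parity.S27).
* `PrimesHaveLevel θ`: the Bombieri–Vinogradov shape with power level `x^{θ−ε}`:
  `∀ A > 0, ∀ ε > 0, ∑_{q ≤ x^{θ−ε}} E*(x; q) ≪ x/(log x)^A`; `PrimesHaveLevelPi θ` is the `π`-variant.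
  `BombieriVinogradovStatement` (`θ < 1/2`; Bombieri 1965, A. I. Vinogradov 1965) and
  `ElliottHalberstam` (`θ < 1`; Elliott–Halberstam 1970) are the two named instances. There is
  deliberately NO `bombieri_vinogradov` theorem here: it is the accepted Wave0 parity.S27, and the derived
  `BombieriVinogradovStatement` is proved in `Statements/Parity/ParityBarrier`.
* `IsWellFactorable D lam` and `PrimesHaveWellFactorableLevel θ` (Bombieri–Friedlander–Iwaniec,
  Acta Math. 156 (1986), §1 and Thm 10: level `x^{4/7−ε}` for well-factorable weights).
* `GeneralizedElliottHalberstam θ` = GEH[θ] in the shape of Polymath 8b (Res. Math. Sci. 1:12 (2014),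
  arXiv:1407.4897), Claim 2.6, via the discrepancy `apDiscrepancy` (Polymath's `Δ(γ; a (q))`).

## Sequence layer

* `SieveSequence`: a nonnegative sequence `a`, an approximate size `X(x)` and a multiplicative density
  `g`; NOTHING ELSE (as in Mathlib's `BoundingSieve`, `0 < g p < 1` is only demanded on the sifting
  primes, through `SieveSequence.IsSiftable`).
* `congrSum` (`A_d(x)`), `remainder` (`R_d(x) = A_d(x) − g(d) X(x)`), `HasLevel`,
  `HasLevelOfDistribution A θ` (level `x^{θ−ε}` for every `ε > 0`), `HasTypeIIRange` (Ford–Maynard 2024,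
  §1: bilinear / Type II information in a range `[x^α, x^β]`).
* `SieveSequence.shiftedPrimes h`: `a n = Λ(n + h)`, `X(x) = x`, `g d = 1/φ(d)` for `(d, h) = 1`, `d ≠ 0`,
  and `0` otherwise, with multiplicativity proved (`isMultiplicative_shiftedPrimesDensity`).

## Design notes

* Finite Dirichlet convolutions `α ⋆ β` are expressed through Mathlib's `ArithmeticFunction` multiplication
  (coefficient sequences are `ArithmeticFunction ℝ`, so they vanish at `0` by construction).
* `primeAPError x q` is a junk value (`sSup ∅ = 0`) for `x < 1`; only `x → ∞` matters in every statement.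
* All asymptotic statements are `IsBigO` along `Filter.atTop` on `ℝ`, exactly as in Wave0.
* Level conventions: `PrimesHaveLevel θ`, `PrimesHaveWellFactorableLevel θ` and
  `HasLevelOfDistribution A θ` carry an `ε`-slack (level `x^{θ−ε}` for every `ε > 0`), whereas
  `GeneralizedElliottHalberstam θ` uses the modulus range `q ≤ x^θ` exactly (faithful to Polymath 8b);
  so implications between the two families of notions only line up after inserting an `ε`.
* Naming: `ElliottHalberstam` (here, `∀ θ < 1`) is prescribed by the outline; it is disambiguated from
  Wave0's `Literature.NumberTheory.Sieve.ElliottHalberstamConjecture` by namespace.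
* Mathlib's `BoundingSieve` / `SelbergSieve` (`Mathlib.NumberTheory.SelbergSieve`) is the finite sieve
  set-up; it is referred to in docstrings for comparison only and not imported (nothing here uses it).
  Mathlib has no `ψ(x; q, a)`, `π(x; q, a)`, well-factorable or level-of-distribution notion.
-/

open Filter Asymptotics Finset
open scoped ArithmeticFunction.Moebius ArithmeticFunction.vonMangoldt ArithmeticFunction.sigma Topology

namespace Literature.NumberTheory.Sieve

/-! ### Prime layer: `ψ(x; q, a)`, `π(x; q, a)` and the level of distribution of the primes -/

/-- `ψ(x; q, a) = ∑_{n ≤ x, n ≡ a (q)} Λ(n)`, the Chebyshev function of a residue class, as a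
finite sum of Mathlib's `ArithmeticFunction.vonMangoldt.residueClass` (Iwaniec–Kowalski §5.6). Body
byte-identical to the accepted Wave0 glue `Literature.NumberTheory.Sieve.ParityWave0.chebyshevPsiMod`. [folklore] -/
noncomputable def LevelOfDistribution.chebyshevPsiMod (q : ℕ) (a : ZMod q) (x : ℝ) : ℝ :=
  ∑ n ∈ range (⌊x⌋₊ + 1), ArithmeticFunction.vonMangoldt.residueClass a n

/-- `π(x; q, a) = #{p ≤ x : p prime, p ≡ a mod q}` (Iwaniec–Kowalski §5.6). Body byte-identical to the
accepted Wave0 glue `Literature.NumberTheory.Sieve.ParityWave0.primeCountingMod`. [folklore] -/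
def LevelOfDistribution.primeCountingMod (q a x : ℕ) : ℕ :=
  #{p ∈ range (x + 1) | p.Prime ∧ p ≡ a [MOD q]}

/-- `E*(x; q) = max_{1 ≤ y ≤ x} max_{a ∈ (ℤ/qℤ)ˣ} |ψ(y; q, a) − y/φ(q)|`, the maximal error term of the
prime number theorem in arithmetic progressions to modulus `q` (Iwaniec–Kowalski (17.2); Bombieri,
Mathematika 12 (1965)). Written as the double `iSup` of Wave0's `bombieri_vinogradov`; for `x ≥ 1` both
suprema are over nonempty sets and bounded (`bddAbove_range_primeAPError`), for `x < 1` the value is the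
junk value `sSup ∅ = 0`. [folklore] -/
noncomputable def primeAPError (x : ℝ) (q : ℕ) : ℝ :=
  ⨆ y : Set.Icc 1 x, ⨆ a : (ZMod q)ˣ, |LevelOfDistribution.chebyshevPsiMod q a y - (y : ℝ) / Nat.totient q|

/-- The inner range of `primeAPError` is bounded above: for fixed `x` and `q ≠ 0` the set of values
`⨆_{a} |ψ(y; q, a) − y/φ(q)|`, `1 ≤ y ≤ x`, is bounded (by `ψ(x) + x`), so the outer `iSup` in
`primeAPError` is a genuine supremum (Iwaniec–Kowalski §17.1). [folklore] -/
theorem bddAbove_range_primeAPError (x : ℝ) (q : ℕ) (hq : q ≠ 0) :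
    BddAbove (Set.range fun y : Set.Icc (1 : ℝ) x ↦
      ⨆ a : (ZMod q)ˣ, |LevelOfDistribution.chebyshevPsiMod q a y - (y : ℝ) / Nat.totient q|) := by
  haveI : NeZero q := ⟨hq⟩
  refine ⟨(∑ n ∈ range (⌊x⌋₊ + 1), Λ n) + x, ?_⟩
  rintro _ ⟨y, rfl⟩
  have hy1 : (1 : ℝ) ≤ y := y.2.1
  have hyx : (y : ℝ) ≤ x := y.2.2
  have hS : 0 ≤ ∑ n ∈ range (⌊x⌋₊ + 1), Λ n :=
    Finset.sum_nonneg fun _ _ => ArithmeticFunction.vonMangoldt_nonneg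
  have hφ : (1 : ℝ) ≤ (Nat.totient q : ℝ) := by
    exact_mod_cast Nat.totient_pos.mpr (Nat.pos_of_ne_zero hq)
  refine ciSup_le fun a => abs_le.mpr ⟨?_, ?_⟩
  · have h1 : 0 ≤ LevelOfDistribution.chebyshevPsiMod q a y :=
      Finset.sum_nonneg fun n _ => ArithmeticFunction.vonMangoldt.residueClass_nonneg (a : ZMod q) n
    have h2 : (y : ℝ) / Nat.totient q ≤ x := (div_le_self (by linarith) hφ).trans hyx
    linarith
  · have h1 : LevelOfDistribution.chebyshevPsiMod q a y ≤ ∑ n ∈ range (⌊x⌋₊ + 1), Λ n :=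
      (Finset.sum_le_sum fun n _ => ArithmeticFunction.vonMangoldt.residueClass_le (a : ZMod q) n).trans
        (Finset.sum_le_sum_of_subset_of_nonneg
          (Finset.range_mono (Nat.succ_le_succ (Nat.floor_le_floor hyx)))
          fun _ _ _ => ArithmeticFunction.vonMangoldt_nonneg)
    have h2 : 0 ≤ (y : ℝ) / Nat.totient q := div_nonneg (by linarith) (Nat.cast_nonneg _)
    linarith

/-- `PrimesHaveLevel θ`: the primes have level of distribution `x^θ` in the Bombieri–Vinogradov sense
(OUTLINE D-SIEVE-5): for every `A > 0` and `ε > 0`,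
`∑_{q ≤ x^{θ−ε}} max_{y ≤ x} max_{(a,q)=1} |ψ(y; q, a) − y/φ(q)| ≪_{A,ε} x/(log x)^A`
(Bombieri, Mathematika 12 (1965); A. I. Vinogradov, Izv. Akad. Nauk 29 (1965); Iwaniec–Kowalski
Thm 17.1). [folklore] -/
def PrimesHaveLevel (θ : ℝ) : Prop :=
  ∀ A : ℝ, 0 < A → ∀ ε : ℝ, 0 < ε →
    (fun x : ℝ => ∑ q ∈ Icc 1 ⌊x ^ (θ - ε)⌋₊, primeAPError x q) =O[atTop]
      fun x : ℝ => x / Real.log x ^ A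

/-- `PrimesHaveLevelPi θ`: the `π`-variant of `PrimesHaveLevel`: for every `A > 0` and `ε > 0`,
`∑_{q ≤ x^{θ−ε}} max_{1 ≤ y ≤ x} max_{(a,q)=1} |π(y; q, a) − π(y)/φ(q)| ≪ x/(log x)^A`
(Iwaniec–Kowalski Thm 17.1 and the remark following it; equivalent to the `ψ`-form by partial
summation, `primesHaveLevel_iff_primesHaveLevelPi`). [folklore] -/
def PrimesHaveLevelPi (θ : ℝ) : Prop :=
  ∀ A : ℝ, 0 < A → ∀ ε : ℝ, 0 < ε →
    (fun x : ℝ => ∑ q ∈ Icc 1 ⌊x ^ (θ - ε)⌋₊,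
        ⨆ y : Set.Icc 1 x, ⨆ a : (ZMod q)ˣ,
          |(LevelOfDistribution.primeCountingMod q (a : ZMod q).val ⌊(y : ℝ)⌋₊ : ℝ) -
            (Nat.primeCounting ⌊(y : ℝ)⌋₊ : ℝ) / Nat.totient q|) =O[atTop]
      fun x : ℝ => x / Real.log x ^ A

/-- The Bombieri–Vinogradov theorem as a level-of-distribution statement: the primes have level `x^θ`
for every `θ < 1/2` (Bombieri, Mathematika 12 (1965); A. I. Vinogradov, Izv. Akad. Nauk 29 (1965);
Iwaniec–Kowalski Thm 17.1; Polymath 8b, arXiv:1407.4897, Thm 2.3). A deep THEOREM (large sieve +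
Vaughan's identity), not in Mathlib; it is derived from the accepted Wave0 parity.S27 in
`Statements/Parity/ParityBarrier`, not restated as a theorem here. [cite: IwaniecKowalski2004, Theorem 17.1] -/
def BombieriVinogradovStatement : Prop :=
  ∀ θ : ℝ, θ < 1 / 2 → PrimesHaveLevel θ

/-- The Elliott–Halberstam conjecture: the primes have level `x^θ` for every `θ < 1`
(P. D. T. A. Elliott–H. Halberstam, "A conjecture in prime number theory", Symposia Math. 4 (INDAM
1968/69), 59–72; restated as Polymath 8b, arXiv:1407.4897, Claim 2.2 `EH[ϑ]` for all `0 < ϑ < 1`, and in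
Cojocaru–Murty, *An Introduction to Sieve Methods*, §9.2). An OPEN CONJECTURE for every `θ > 1/2`
(Polymath 8b, after Thm 2.3: "such an estimate remains unproven"; only `θ < 1/2` = Bombieri–Vinogradov is
known, and the endpoint `θ = 1` is false by Friedlander–Granville). Following CONVENTIONS it is a
`def … : Prop` only: there is and can be no `ElliottHalberstam_holds`; users take `(h : ElliottHalberstam)`.
[cite: ElliottHalberstam1970, Conjecture (= Polymath 8b Claim 2.2)] -/
def LevelOfDistribution.ElliottHalberstam : Prop :=
  ∀ θ : ℝ, θ < 1 → PrimesHaveLevel θ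

/-- Monotonicity of the level: level `x^θ` implies level `x^θ'` for `θ' ≤ θ` (immediate: the sum over
`q ≤ x^{θ'−ε}` is a sub-sum of nonnegative terms). [folklore] -/
theorem PrimesHaveLevel.mono {θ θ' : ℝ} (h : PrimesHaveLevel θ) (hθ : θ' ≤ θ) :
    PrimesHaveLevel θ' := by
  intro A hA ε hε
  refine IsBigO.trans (IsBigO.of_bound 1 ?_) (h A hA ε hε)
  filter_upwards [eventually_ge_atTop 1] with x hx
  have h0 : ∀ q, 0 ≤ primeAPError x q := fun q =>
    Real.iSup_nonneg fun _ => Real.iSup_nonneg fun _ => abs_nonneg _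
  rw [one_mul, Real.norm_eq_abs, Real.norm_eq_abs, abs_of_nonneg (Finset.sum_nonneg fun q _ => h0 q),
    abs_of_nonneg (Finset.sum_nonneg fun q _ => h0 q)]
  refine Finset.sum_le_sum_of_subset_of_nonneg (Finset.Icc_subset_Icc le_rfl ?_) fun q _ _ => h0 q
  exact Nat.floor_le_floor (Real.rpow_le_rpow_of_exponent_le hx (by linarith))

/-- The `ψ`- and `π`-forms of "level of distribution `x^θ`" are equivalent (partial summation and the
prime number theorem `ψ(y) = y + O(y/(log y)^A)`, prime powers contributing `O(√y)`;
Iwaniec–Kowalski §17.1). [cite: IwaniecKowalski2004, §17.1] -/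
def primesHaveLevel_iff_primesHaveLevelPi : Prop :=
  ∀ (θ : ℝ),
    PrimesHaveLevel θ ↔ PrimesHaveLevelPi θ

/-! ### Well-factorable weights (Bombieri–Friedlander–Iwaniec) -/

/-- `IsWellFactorable D lam`: `lam` is a well-factorable function of level `D`
(Bombieri–Friedlander–Iwaniec, Acta Math. 156 (1986), §1; Iwaniec–Kowalski §13.6 / (22.101)):
`|lam n| ≤ 1`, `lam` is supported on `1 ≤ n ≤ D`, and for every factorisation `D = D₁ D₂` with
`D₁, D₂ ≥ 1` one can write `lam = α ⋆ β` (Dirichlet convolution, here Mathlib's product of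
`ArithmeticFunction`s) with `|α|, |β| ≤ 1`, `α` supported on `n ≤ D₁` and `β` on `n ≤ D₂`. [folklore] -/
def IsWellFactorable (D : ℝ) (lam : ℕ → ℝ) : Prop :=
  (∀ n, |lam n| ≤ 1) ∧ lam 0 = 0 ∧ (∀ n : ℕ, D < n → lam n = 0) ∧
    ∀ D₁ D₂ : ℝ, 1 ≤ D₁ → 1 ≤ D₂ → D₁ * D₂ = D →
      ∃ α β : ArithmeticFunction ℝ,
        (∀ n, |α n| ≤ 1) ∧ (∀ n, |β n| ≤ 1) ∧
        (∀ n : ℕ, D₁ < n → α n = 0) ∧ (∀ n : ℕ, D₂ < n → β n = 0) ∧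
        ∀ n, lam n = (α * β) n

/-- A well-factorable function is bounded by `1` in absolute value (the first clause of the
definition; BFI 1986 §1). [cite: BFI1986, §1] -/
theorem IsWellFactorable.abs_le_one {D : ℝ} {lam : ℕ → ℝ} (h : IsWellFactorable D lam) (n : ℕ) :
    |lam n| ≤ 1 :=
  h.1 n

/-- `PrimesHaveWellFactorableLevel θ`: the primes have level of distribution `x^θ` with respect to
well-factorable weights (Bombieri–Friedlander–Iwaniec, Acta Math. 156 (1986), Thm 10): for every
fixed integer `a ≠ 0`, every `A > 0`,
`ε > 0` and every family `λ_x` of well-factorable functions of level `x^{θ−ε}`,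
`∑_{q ≤ x^{θ−ε}, (q,a)=1} λ_x(q) (ψ(x; q, a) − x/φ(q)) ≪_{a,A,ε} x/(log x)^A`. The residue is the fixed
integer `a` (not a maximum over residues), as in BFI. [folklore] -/
def PrimesHaveWellFactorableLevel (θ : ℝ) : Prop :=
  ∀ a : ℤ, a ≠ 0 → ∀ A : ℝ, 0 < A → ∀ ε : ℝ, 0 < ε → ∀ lam : ℝ → ℕ → ℝ,
    (∀ x, IsWellFactorable (x ^ (θ - ε)) (lam x)) →
      (fun x : ℝ => ∑ q ∈ (Icc 1 ⌊x ^ (θ - ε)⌋₊).filter (fun q : ℕ => IsCoprime (q : ℤ) a),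
          lam x q * (LevelOfDistribution.chebyshevPsiMod q (a : ZMod q) x - x / Nat.totient q)) =O[atTop]
        fun x : ℝ => x / Real.log x ^ A

/-- Bombieri–Friedlander–Iwaniec (Acta Math. 156 (1986), Thm 10): the primes have well-factorable
level `x^{4/7−ε}`. [cite: BombieriFriedlanderIwaniecActa1986, Theorem 10] -/
def bfi_wellFactorable_level : Prop :=
  PrimesHaveWellFactorableLevel (4 / 7)

/-! ### Generalised Elliott–Halberstam (Polymath 8b, Claim 2.6) -/

/-- The (signed) discrepancy of a sequence `γ` in the residue class `a (mod q)` up to `N`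
(Polymath 8b, arXiv:1407.4897, (1.1)):
`Δ(γ; a (q)) = ∑_{n ≤ N, n ≡ a (q)} γ(n) − (1/φ(q)) ∑_{n ≤ N, (n,q)=1} γ(n)`. The cut-off `N` is explicit
because our sequences are plain functions `ℕ → ℝ` (Polymath's `γ` are finitely supported). [cite: arXiv14074897] -/
noncomputable def apDiscrepancy (γ : ℕ → ℝ) (N q : ℕ) (a : ZMod q) : ℝ :=
  (∑ n ∈ (Icc 1 N).filter (fun n : ℕ => (n : ZMod q) = a), γ n) -
    (∑ n ∈ (Icc 1 N).filter (fun n : ℕ => n.Coprime q), γ n) / Nat.totient q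

/-- `GeneralizedElliottHalberstam θ` = GEH[θ] in the shape of Polymath 8b (Res. Math. Sci. 1:12
(2014), arXiv:1407.4897), Claim 2.6. Fix `ε > 0`, `A > 0`, a divisor-bound exponent `k` and a
support ratio `K ≥ 1`. Let `N = N(x)`, `M = M(x)` with `x^ε ≤ N, M ≤ x^{1−ε}` and `NM ≍ x`, and let
`α_x`, `β_x` be coefficient sequences located at scales `N`, `M`, i.e. supported on `[N, KN]`,
`[M, KM]` (Polymath's `[cN, CN]`; the lower constant `c` is absorbed by rescaling `N`, the ratio
`C/c = K` is quantified), divisor-bounded (`|α_x(n)| ≤ τ(n)^k (log x)^k`, likewise `β_x`), with `β_x`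
obeying the Siegel–Walfisz condition
`|Δ(β_x 1_{(·,r)=1}; a (q))| ≤ C_B τ(qr)^k M (log x)^{−B}` for all `q, r ≥ 1`, all `B > 0`. Then
`∑_{q ≤ x^θ} max_{a ∈ (ℤ/qℤ)ˣ} |Δ(α_x ⋆ β_x; a (q))| ≪ x (log x)^{−A}`.
Simplifications (documented): `Q ≪ x^θ` is specialised to `Q = x^θ`; all "fixed"/`≪` hypotheses are
made eventual in `x` with explicit constants; `α ⋆ β` is Mathlib's `ArithmeticFunction` product and the
discrepancy is `apDiscrepancy` with cut-offs `⌊KM⌋` (Siegel–Walfisz) and `⌊K²NM⌋` (conclusion), which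
cover the supports. GEH[θ] for all `θ < 1` is open; GEH[θ] for `θ < 1/2` is Motohashi's theorem
(Polymath 8b Thm 2.7(iii)). [cite: arXiv14074897] -/
def GeneralizedElliottHalberstam (θ : ℝ) : Prop :=
  ∀ ε : ℝ, 0 < ε → ∀ A : ℝ, 0 < A → ∀ k : ℕ, ∀ K : ℝ, 1 ≤ K → ∀ N M : ℝ → ℝ,
    ∀ α β : ℝ → ArithmeticFunction ℝ,
    (∀ᶠ x in atTop, x ^ ε ≤ N x ∧ N x ≤ x ^ (1 - ε) ∧ x ^ ε ≤ M x ∧ M x ≤ x ^ (1 - ε)) →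
    (∃ C : ℝ, 1 ≤ C ∧ ∀ᶠ x in atTop, x / C ≤ N x * M x ∧ N x * M x ≤ C * x) →
    (∀ x, ∀ n : ℕ, (n : ℝ) < N x ∨ K * N x < n → α x n = 0) →
    (∀ x, ∀ n : ℕ, (n : ℝ) < M x ∨ K * M x < n → β x n = 0) →
    (∀ᶠ x in atTop, ∀ n : ℕ, |α x n| ≤ (σ 0 n : ℝ) ^ k * Real.log x ^ k ∧
      |β x n| ≤ (σ 0 n : ℝ) ^ k * Real.log x ^ k) →
    (∀ B : ℝ, 0 < B → ∃ C : ℝ, ∀ᶠ x in atTop, ∀ q r : ℕ, 1 ≤ q → 1 ≤ r → ∀ a : (ZMod q)ˣ,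
      |apDiscrepancy (fun n => if n.Coprime r then β x n else 0) ⌊K * M x⌋₊ q a| ≤
        C * (σ 0 (q * r) : ℝ) ^ k * M x / Real.log x ^ B) →
    (fun x : ℝ => ∑ q ∈ Icc 1 ⌊x ^ θ⌋₊,
        ⨆ a : (ZMod q)ˣ,
          |apDiscrepancy (fun n => (α x * β x) n) ⌊K * K * (N x * M x)⌋₊ q a|) =O[atTop]
      fun x : ℝ => x / Real.log x ^ A

/-! ### Sequence layer: sifted sequences and their level of distribution -/

/-- A sifted sequence in the sense of sieve theory (Halberstam–Richert, *Sieve Methods*, Ch. 1;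
Friedlander–Iwaniec, *Opera de Cribro*, §1.3; compare Mathlib's finite `BoundingSieve`): a nonnegative
sequence `a = (a_n)`, an approximation `size x = X(x)` to `∑_{n ≤ x} a_n`, and a multiplicative density
function `density = g` such that `A_d(x) ≈ g(d) X(x)`. Deliberately NOTHING ELSE is bundled: as in
Mathlib's `BoundingSieve`, `0 < g(p) < 1` is only required on the sifting primes, via
`SieveSequence.IsSiftable`. [folklore] -/
structure SieveSequence where
  /-- The sifted sequence `a_n ≥ 0`. -/
  a : ℕ → ℝ
  /-- Nonnegativity of the sequence. -/
  a_nonneg : ∀ n, 0 ≤ a n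
  /-- The expected size `X(x)` of `∑_{n ≤ x} a_n`. -/
  size : ℝ → ℝ
  /-- The density function `g(d)`, so that `A_d(x) ≈ g(d) X(x)`. -/
  density : ArithmeticFunction ℝ
  /-- The density is multiplicative. -/
  density_mult : density.IsMultiplicative

namespace SieveSequence

/-- `A.IsSiftable P`: the density satisfies `0 < g(p) < 1` for every prime `p ∣ P` (the sifting range),
exactly the hypotheses `nu_pos_of_prime`, `nu_lt_one_of_prime` of Mathlib's `BoundingSieve`
(Halberstam–Richert Ch. 1, (Ω₁)). [folklore] -/
def IsSiftable (A : SieveSequence) (P : ℕ) : Prop :=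
  ∀ p : ℕ, p.Prime → p ∣ P → 0 < A.density p ∧ A.density p < 1

/-- `A.congrSum d x = A_d(x) = ∑_{n ≤ x, d ∣ n} a_n` (Halberstam–Richert Ch. 1, (1.2)). [folklore] -/
noncomputable def congrSum (A : SieveSequence) (d : ℕ) (x : ℝ) : ℝ :=
  ∑ n ∈ (Ioc 0 ⌊x⌋₊).filter (d ∣ ·), A.a n

/-- `A.remainder d x = R_d(x) = A_d(x) − g(d) X(x)` (Halberstam–Richert Ch. 1, (1.4)). [folklore] -/
noncomputable def remainder (A : SieveSequence) (d : ℕ) (x : ℝ) : ℝ :=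
  A.congrSum d x - A.density d * A.size x

/-- `A.HasLevel D`: the sequence has level of distribution `D(x)`: for every `B > 0`,
`∑_{d ≤ D(x), d squarefree} |R_d(x)| ≪_B X(x)/(log x)^B` (Friedlander–Iwaniec, *Opera de Cribro*,
(1.24); Ford–Maynard 2024 §1, "Type I information"). [cite: FordMaynard2024, §1  "Type I information"] -/
def HasLevel (A : SieveSequence) (D : ℝ → ℝ) : Prop :=
  ∀ B : ℝ, 0 < B →
    (fun x : ℝ => ∑ d ∈ (Icc 1 ⌊D x⌋₊).filter Squarefree, |A.remainder d x|) =O[atTop]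
      fun x : ℝ => A.size x / Real.log x ^ B

end SieveSequence

/-- `HasLevelOfDistribution A θ`: the sifted sequence `A` has level of distribution `x^θ`, i.e. level
`x^{θ−ε}` for every `ε > 0` (OUTLINE D-SIEVE-5; Friedlander–Iwaniec, *Opera de Cribro*, §1.3). [folklore] -/
def HasLevelOfDistribution (A : SieveSequence) (θ : ℝ) : Prop :=
  ∀ ε : ℝ, 0 < ε → A.HasLevel (fun x => x ^ (θ - ε))

/-- `HasTypeIIRange A α β`: Type II (bilinear) information for `A` in the range `[x^α, x^β]`
(Ford–Maynard, "On the theory of prime producing sieves" (2024), §1): for every `B > 0` and all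
`1`-bounded coefficient families `u_x`, `v_x`,
`∑_{x^α ≤ m ≤ x^β} ∑_{mn ≤ x} u_x(m) v_x(n) (a_{mn} − X(x)/x) ≪_B X(x)/(log x)^B`,
i.e. bilinear sums of `a` against the constant comparison sequence `X(x)/x` cancel. This is the
Ford–Maynard normalisation `A_d ≈ X/d` and is meaningful ONLY for sequences with density
`A.density d = 1/d`; for any other density (e.g. `SieveSequence.shiftedPrimes h`, density `1/φ(d)`)
the predicate fails for every non-trivial range, so it must not be used as a hypothesis on such
sequences. Design choice: coefficients are `1`-bounded (Ford–Maynard allow divisor-bounded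
coefficients; the `1`-bounded axiom is the one consumed by Harman's sieve, *Prime-Detecting Sieves*
§3.2). [folklore] -/
def HasTypeIIRange (A : SieveSequence) (α β : ℝ) : Prop :=
  ∀ B : ℝ, 0 < B → ∀ u v : ℝ → ℕ → ℝ, (∀ x m, |u x m| ≤ 1) → (∀ x n, |v x n| ≤ 1) →
    (fun x : ℝ => ∑ m ∈ Icc ⌈x ^ α⌉₊ ⌊x ^ β⌋₊, ∑ n ∈ Icc 1 ⌊x / m⌋₊,
        u x m * v x n * (A.a (m * n) - A.size x / x)) =O[atTop]
      fun x : ℝ => A.size x / Real.log x ^ B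

/-! ### The shifted primes as a sifted sequence -/

/-- The density of the shifted primes `n ↦ Λ(n + h)`: `g(d) = 1/φ(d)` if `(d, h) = 1` and `d ≠ 0`,
`g(d) = 0` otherwise (Halberstam–Richert Ch. 1, Example 5). For `h = 2`, `g 2 = 0`. [folklore] -/
noncomputable def shiftedPrimesDensity (h : ℕ) : ArithmeticFunction ℝ :=
  ⟨fun d => if d.Coprime h ∧ d ≠ 0 then ((Nat.totient d : ℝ))⁻¹ else 0, by simp⟩

/-- Unfolding lemma for `shiftedPrimesDensity` (definition). [folklore] -/
@[simp]
theorem shiftedPrimesDensity_apply (h d : ℕ) :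
    shiftedPrimesDensity h d = if d.Coprime h ∧ d ≠ 0 then ((Nat.totient d : ℝ))⁻¹ else 0 :=
  rfl

/-- The shifted-primes density `d ↦ 1/φ(d) · 1_{(d,h)=1}` is multiplicative (from `Nat.totient_mul`
and `Nat.Coprime.mul`; Halberstam–Richert Ch. 1, Example 5). [folklore] -/
theorem isMultiplicative_shiftedPrimesDensity (h : ℕ) :
    (shiftedPrimesDensity h).IsMultiplicative := by
  refine ⟨by simp, fun {m n} hmn => ?_⟩
  simp only [shiftedPrimesDensity_apply, Nat.coprime_mul_iff_left, mul_ne_zero_iff]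
  by_cases hm : m.Coprime h ∧ m ≠ 0
  · by_cases hn : n.Coprime h ∧ n ≠ 0
    · rw [if_pos ⟨⟨hm.1, hn.1⟩, hm.2, hn.2⟩, if_pos hm, if_pos hn, Nat.totient_mul hmn,
        Nat.cast_mul, mul_inv]
    · rw [if_neg hn, mul_zero, if_neg]
      rintro ⟨⟨-, h1⟩, -, h2⟩
      exact hn ⟨h1, h2⟩
  · rw [if_neg hm, zero_mul, if_neg]
    rintro ⟨⟨h1, -⟩, h2, -⟩
    exact hm ⟨h1, h2⟩

/-- The shifted primes as a sifted sequence (OUTLINE D-SIEVE-5, finding 1; Halberstam–Richert Ch. 1,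
Example 5): `a n = Λ(n + h)`, `X(x) = x`, `g(d) = 1/φ(d)` for `(d, h) = 1`, `d ≠ 0` (else `0`). Then
`A_d(x) = ψ(⌊x⌋ + h; d, h) − ψ(h; d, h)` (`shiftedPrimes_congrSum_eq`), so `R_d(x)` agrees with the
prime-layer error `ψ(x; d, h) − x/φ(d)` up to `O(log x)`; for `h = 2`, `g 2 = 0` (only odd `d` count). [folklore] -/
noncomputable def SieveSequence.shiftedPrimes (h : ℕ) : SieveSequence where
  a n := Λ (n + h)
  a_nonneg _ := ArithmeticFunction.vonMangoldt_nonneg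
  size x := x
  density := shiftedPrimesDensity h
  density_mult := isMultiplicative_shiftedPrimesDensity h

/-- `A_d(x)` for the shifted primes is a difference of two values of `ψ(·; d, h)`:
`∑_{n ≤ x, d ∣ n} Λ(n + h) = ψ(⌊x⌋ + h; d, h) − ψ(h; d, h)` (substitute `m = n + h`; elementary). [folklore] -/
theorem SieveSequence.shiftedPrimes_congrSum_eq (h d : ℕ) (x : ℝ) :
    (SieveSequence.shiftedPrimes h).congrSum d x =
      LevelOfDistribution.chebyshevPsiMod d (h : ZMod d) ((⌊x⌋₊ + h : ℕ) : ℝ) - LevelOfDistribution.chebyshevPsiMod d (h : ZMod d) h := by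
  simp only [SieveSequence.congrSum, SieveSequence.shiftedPrimes, LevelOfDistribution.chebyshevPsiMod, Nat.floor_natCast]
  rw [Finset.sum_filter, show ⌊x⌋₊ + h + 1 = (h + 1) + ⌊x⌋₊ by ring,
    Finset.sum_range_add_sub_sum_range, ← Finset.Ico_add_one_add_one_eq_Ioc,
    Finset.sum_Ico_eq_sum_range, Nat.zero_add, Nat.add_sub_cancel]
  refine Finset.sum_congr rfl fun k _ => ?_
  have hiff : ((h + 1 + k : ℕ) : ZMod d) = (h : ZMod d) ↔ d ∣ 1 + k := by
    rw [ZMod.natCast_eq_natCast_iff, Nat.ModEq.comm, Nat.modEq_iff_dvd' (by omega),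
      show h + 1 + k - h = 1 + k by omega]
  simp only [ArithmeticFunction.vonMangoldt.residueClass, Set.indicator_apply, Set.mem_setOf_eq,
    hiff, show 1 + k + h = h + 1 + k by ring]

/-- Level of distribution passes from the prime layer to the shifted primes: if the primes have level
`x^θ` (`PrimesHaveLevel θ`, BV shape) and `h ≠ 0`, then the sifted sequence `shiftedPrimes h` has level of
distribution `x^θ` (`R_d(x) = ψ(⌊x⌋+h; d, h) − ψ(h; d, h) − x/φ(d)` for `(d,h)=1`, and
`|R_d(x)| ≤ ∑_{n ≤ x, d ∣ n} Λ(n+h) ≪ log x · log h`-many terms for `(d, h) > 1` squarefree;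
Halberstam–Richert Ch. 1, Example 5 and Thm 3.8). [cite: HalberstamRichert1974, Ch. 1 Example 5 and Thm. 3.8] -/
def hasLevelOfDistribution_shiftedPrimes_of_primesHaveLevel : Prop :=
  ∀ {h : ℕ} (hh : h ≠ 0) {θ : ℝ} (hθ : PrimesHaveLevel θ),
    HasLevelOfDistribution (SieveSequence.shiftedPrimes h) θ

end Literature.NumberTheory.Sieve

namespace Literature.NumberTheory.Sieve

/-! ### Discharge of `hasLevelOfDistribution_shiftedPrimes_of_primesHaveLevel`

The transfer from the prime layer (`PrimesHaveLevel θ`, the Bombieri–Vinogradov shape for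
`E*(x; q)`) to the sifted sequence `𝒜 = {Λ(n + h)}` is the standard verification of the remainder
condition for shifted primes in Halberstam–Richert, *Sieve Methods*, Ch. 1, Example 5 (for
`(d, h) = 1`, `R_d(x) = (ψ(⌊x⌋ + h; d, h) − (⌊x⌋+h)/φ(d)) − (ψ(h; d, h) − h/φ(d)) + (⌊x⌋ − x)/φ(d)`, each
of the first two terms bounded by `E*(⌊x⌋ + h; d)`), combined with Bombieri's theorem in the averaged
form `∑_{d} μ²(d) max |R_d| ≪ x/log^A x` used there (Ch. 3, Thm 3.8). Here the Bombieri input is the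
hypothesis `PrimesHaveLevel θ`, so the proof below is elementary. Two points not spelled out in the
source are needed for the Lean statement as vendored:

* moduli `d` with `(d, h) > 1` have density `0`, and then `R_d(x) = A_d(x) ≤ log(⌊x⌋ + h)`
  (`shiftedPrimes_congrSum_le_log`: all contributing `n + h` are powers of one prime `p ∣ (d, h)`);
* the hypothesis `PrimesHaveLevel θ` forces `θ ≤ 1` (`PrimesHaveLevel.le_one`: for `x < q ≤ 2x`,
  `ψ(x; q, 1) = 0` so `E*(x; q) ≥ x/φ(q) ≥ 1/2`), which is what makes the `≪ x^{θ−ε} log x` trivial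
  terms admissible.
[cite: HalberstamRichert1974, Ch. 1 Example 5 and Thm. 3.8] -/

/-- `E*(x; q) ≥ 0` (a supremum of absolute values, with the `Real.iSup` junk value `0` otherwise). [folklore] -/
theorem primeAPError_nonneg (x : ℝ) (q : ℕ) : 0 ≤ primeAPError x q :=
  Real.iSup_nonneg fun _ => Real.iSup_nonneg fun _ => abs_nonneg _

/-- Each individual error `|ψ(y; q, a) − y/φ(q)|`, `1 ≤ y ≤ x`, `a ∈ (ℤ/qℤ)ˣ`, is at most `E*(x; q)`
(definition of the double maximum; Iwaniec–Kowalski (17.2)). [folklore] -/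
theorem abs_sub_le_primeAPError {x y : ℝ} {q : ℕ} (hq : q ≠ 0) (hy1 : 1 ≤ y) (hyx : y ≤ x)
    (a : (ZMod q)ˣ) :
    |LevelOfDistribution.chebyshevPsiMod q a y - y / Nat.totient q| ≤ primeAPError x q := by
  haveI : NeZero q := ⟨hq⟩
  unfold primeAPError
  refine le_trans ?_ (le_ciSup (bddAbove_range_primeAPError x q hq) ⟨y, hy1, hyx⟩)
  exact le_ciSup (f := fun a : (ZMod q)ˣ => |LevelOfDistribution.chebyshevPsiMod q a y - y / Nat.totient q|)
    (Set.finite_range _).bddAbove a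

/-- For `q > ⌊x⌋` (and `q > 1`) the class `1 mod q` contains no `n ≤ x` other than `n = 1`, so
`ψ(x; q, 1) = 0`. [folklore] -/
theorem chebyshevPsiMod_one_eq_zero {x : ℝ} {q : ℕ} (hq : ⌊x⌋₊ < q) (hq1 : 1 < q) :
    LevelOfDistribution.chebyshevPsiMod q 1 x = 0 := by
  unfold LevelOfDistribution.chebyshevPsiMod
  refine Finset.sum_eq_zero fun n hn => ?_
  rw [Finset.mem_range] at hn
  simp only [ArithmeticFunction.vonMangoldt.residueClass, Set.indicator_apply, Set.mem_setOf_eq]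
  split_ifs with h1
  · have h1' : (n : ZMod q) = ((1 : ℕ) : ZMod q) := by rw [Nat.cast_one]; exact h1
    rw [ZMod.natCast_eq_natCast_iff', Nat.mod_eq_of_lt (by omega), Nat.mod_eq_of_lt hq1] at h1'
    subst h1'
    simp
  · rfl

/-- A level of distribution of the primes in the Bombieri–Vinogradov shape can only hold with exponent
`θ ≤ 1`: if `θ > 1`, take `ε = (θ−1)/2`; for `⌊x⌋ < q ≤ 2⌊x⌋ ≤ x^{θ−ε}` one has `ψ(x; q, 1) = 0`, so
`E*(x; q) ≥ x/φ(q) ≥ 1/2` and `∑_{q ≤ x^{θ−ε}} E*(x; q) ≥ ⌊x⌋/2`, contradicting `≪ x/log x`. [folklore] -/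
theorem PrimesHaveLevel.le_one {θ : ℝ} (h : PrimesHaveLevel θ) : θ ≤ 1 := by
  by_contra hθ
  rw [not_le] at hθ
  set ε : ℝ := (θ - 1) / 2 with hε_def
  have hε : 0 < ε := by rw [hε_def]; linarith
  have hθε : θ - ε = 1 + ε := by rw [hε_def]; ring
  obtain ⟨C, hC, hCb⟩ := (h 1 one_pos ε hε).exists_pos
  have hev := hCb.bound
  have h2 : ∀ᶠ x : ℝ in atTop, 2 ≤ x ^ ε := (tendsto_rpow_atTop hε).eventually_ge_atTop 2
  have h3 : ∀ᶠ x : ℝ in atTop, 4 * C ≤ Real.log x :=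
    Real.tendsto_log_atTop.eventually_ge_atTop _
  obtain ⟨x, hx, hxε, hxC, hx3⟩ := (hev.and (h2.and (h3.and (eventually_ge_atTop 3)))).exists
  have hx0 : 0 < x := by linarith
  have hx1 : 1 ≤ x := by linarith
  have hlogpos : 0 < Real.log x := Real.log_pos (by linarith)
  set N := ⌊x⌋₊ with hN
  have hN1 : 3 ≤ N := Nat.le_floor (by exact_mod_cast hx3)
  have hNx : (N : ℝ) ≤ x := Nat.floor_le hx0.le
  have hsub : Icc (N + 1) (2 * N) ⊆ Icc 1 ⌊x ^ (θ - ε)⌋₊ := by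
    refine Finset.Icc_subset_Icc (by omega) (Nat.le_floor ?_)
    rw [hθε, Real.rpow_add hx0, Real.rpow_one]
    push_cast
    nlinarith
  have hterm : ∀ q ∈ Icc (N + 1) (2 * N), (1 / 2 : ℝ) ≤ primeAPError x q := by
    intro q hq
    rw [Finset.mem_Icc] at hq
    have hq0 : q ≠ 0 := by omega
    haveI : NeZero q := ⟨hq0⟩
    have key := abs_sub_le_primeAPError (x := x) hq0 hx1 le_rfl 1
    rw [Units.val_one, chebyshevPsiMod_one_eq_zero (by omega) (by omega), zero_sub, abs_neg] at key
    refine le_trans ?_ ((le_abs_self _).trans key)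
    have hφ : (Nat.totient q : ℝ) ≤ 2 * N := by
      exact_mod_cast (Nat.totient_le q).trans hq.2
    have hφpos : (0 : ℝ) < Nat.totient q := by
      exact_mod_cast Nat.totient_pos.mpr (Nat.pos_of_ne_zero hq0)
    rw [div_le_div_iff₀ (by norm_num) hφpos]
    have : (1 : ℝ) ≤ N := by exact_mod_cast (show 1 ≤ N by omega)
    nlinarith
  have hlow : (N : ℝ) / 2 ≤ ∑ q ∈ Icc 1 ⌊x ^ (θ - ε)⌋₊, primeAPError x q := by
    calc (N : ℝ) / 2 = ∑ q ∈ Icc (N + 1) (2 * N), (1 / 2 : ℝ) := by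
          rw [Finset.sum_const, Nat.card_Icc, nsmul_eq_mul]
          have : 2 * N + 1 - (N + 1) = N := by omega
          rw [this]; ring
      _ ≤ ∑ q ∈ Icc (N + 1) (2 * N), primeAPError x q := Finset.sum_le_sum hterm
      _ ≤ _ := Finset.sum_le_sum_of_subset_of_nonneg hsub fun q _ _ => primeAPError_nonneg x q
  have hup : ∑ q ∈ Icc 1 ⌊x ^ (θ - ε)⌋₊, primeAPError x q ≤ C * (x / Real.log x) := by
    have := hx
    rw [Real.norm_eq_abs, Real.norm_eq_abs, Real.rpow_one,
      abs_of_nonneg (Finset.sum_nonneg fun q _ => primeAPError_nonneg x q),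
      abs_of_nonneg (div_nonneg hx0.le hlogpos.le)] at this
    exact this
  have hup2 : C * (x / Real.log x) ≤ x / 4 := by
    rw [mul_div_assoc', div_le_div_iff₀ hlogpos (by norm_num)]
    nlinarith
  have hfl : x < N + 1 := by rw [hN]; exact Nat.lt_floor_add_one x
  linarith

/-- If a prime `p` divides both `d` and `h`, then every `n` with `d ∣ n` and `Λ(n + h) ≠ 0` has `n + h`
a power of `p`; hence `A_d(x) = ∑_{n ≤ x, d ∣ n} Λ(n + h) ≤ ∑_{m ∣ p^K} Λ(m) = log p^K ≤ log(⌊x⌋ + h)`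
with `K = ⌊log_p(⌊x⌋ + h)⌋` (elementary; the moduli not coprime to `h` in Halberstam–Richert Ch. 1,
Example 5). [folklore] -/
theorem shiftedPrimes_congrSum_le_log {h d p : ℕ} (hh : h ≠ 0) (hp : p.Prime) (hpd : p ∣ d)
    (hph : p ∣ h) (x : ℝ) :
    (SieveSequence.shiftedPrimes h).congrSum d x ≤ Real.log ((⌊x⌋₊ + h : ℕ) : ℝ) := by
  set N : ℕ := ⌊x⌋₊ + h with hN
  have hN0 : N ≠ 0 := by omega
  set K : ℕ := Nat.log p N with hK
  have hpK : p ^ K ≤ N := Nat.pow_log_le_self p hN0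
  have hpK0 : p ^ K ≠ 0 := pow_ne_zero _ hp.ne_zero
  simp only [SieveSequence.congrSum, SieveSequence.shiftedPrimes]
  calc ∑ n ∈ (Ioc 0 ⌊x⌋₊).filter (d ∣ ·), Λ (n + h)
      = ∑ n ∈ ((Ioc 0 ⌊x⌋₊).filter (d ∣ ·)).filter (fun n => Λ (n + h) ≠ 0), Λ (n + h) :=
        (Finset.sum_filter_ne_zero _).symm
    _ = ∑ m ∈ (((Ioc 0 ⌊x⌋₊).filter (d ∣ ·)).filter (fun n => Λ (n + h) ≠ 0)).image (· + h), Λ m := by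
        rw [Finset.sum_image fun a _ b _ hab => add_left_injective h hab]
    _ ≤ ∑ m ∈ (p ^ K).divisors, Λ m := by
        refine Finset.sum_le_sum_of_subset_of_nonneg ?_ fun _ _ _ => ArithmeticFunction.vonMangoldt_nonneg
        intro m hm
        simp only [Finset.mem_image, Finset.mem_filter, Finset.mem_Ioc] at hm
        obtain ⟨n, ⟨⟨⟨-, hnx⟩, hdn⟩, hΛ⟩, rfl⟩ := hm
        rw [Nat.mem_divisors]
        refine ⟨?_, hpK0⟩
        obtain ⟨q, k, hq, hk, hqk⟩ :=
          (isPrimePow_nat_iff _).mp (ArithmeticFunction.vonMangoldt_ne_zero_iff.mp hΛ)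
        have hpn : p ∣ n + h := Nat.dvd_add (hpd.trans hdn) hph
        rw [← hqk] at hpn
        have hpq : p = q := (Nat.prime_dvd_prime_iff_eq hp hq).mp (hp.dvd_of_dvd_pow hpn)
        subst hpq
        rw [← hqk]
        refine pow_dvd_pow p (Nat.le_log_of_pow_le hp.one_lt ?_)
        rw [hqk]
        omega
    _ = Real.log ((p ^ K : ℕ) : ℝ) := ArithmeticFunction.vonMangoldt_sum
    _ ≤ Real.log (N : ℝ) :=
        Real.log_le_log (by exact_mod_cast Nat.pos_of_ne_zero hpK0) (by exact_mod_cast hpK)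

/-- Unfolding lemma: the density of `shiftedPrimes h` is `shiftedPrimesDensity h` (definition). [folklore] -/
theorem SieveSequence.shiftedPrimes_density (h : ℕ) :
    (SieveSequence.shiftedPrimes h).density = shiftedPrimesDensity h := rfl

/-- Unfolding lemma: the size function of `shiftedPrimes h` is `X(x) = x` (definition). [folklore] -/
theorem SieveSequence.shiftedPrimes_size (h : ℕ) (x : ℝ) :
    (SieveSequence.shiftedPrimes h).size x = x := rfl

/-- The remainder of the shifted primes at one modulus `d ≥ 1`, for `x ≥ 1` and `N = ⌊x⌋ + h`:
`|R_d(x)| ≤ 2 E*(N; d) + 1 + log N`. For `(d, h) = 1` this is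
`R_d(x) = (ψ(N; d, h) − N/φ(d)) − (ψ(h; d, h) − h/φ(d)) + (⌊x⌋ − x)/φ(d)` (Halberstam–Richert Ch. 1,
Example 5); for `(d, h) > 1` it is `shiftedPrimes_congrSum_le_log`. [folklore] -/
theorem shiftedPrimes_abs_remainder_le {h : ℕ} (hh : h ≠ 0) {d : ℕ} (hd : d ≠ 0) (x : ℝ)
    (hx : 1 ≤ x) :
    |(SieveSequence.shiftedPrimes h).remainder d x| ≤
      2 * primeAPError ((⌊x⌋₊ + h : ℕ) : ℝ) d + (1 + Real.log ((⌊x⌋₊ + h : ℕ) : ℝ)) := by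
  set N : ℝ := ((⌊x⌋₊ + h : ℕ) : ℝ) with hN
  have hh1 : (1 : ℝ) ≤ h := by exact_mod_cast Nat.pos_of_ne_zero hh
  have hNeq : N = (⌊x⌋₊ : ℝ) + h := by rw [hN]; push_cast; rfl
  have hhN : (h : ℝ) ≤ N := by rw [hNeq]; linarith [(Nat.cast_nonneg (⌊x⌋₊) : (0 : ℝ) ≤ _)]
  have hN1 : 1 ≤ N := hh1.trans hhN
  have hE := primeAPError_nonneg N d
  have hlogN : 0 ≤ Real.log N := Real.log_nonneg hN1
  have hφ1 : (1 : ℝ) ≤ Nat.totient d := by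
    exact_mod_cast Nat.totient_pos.mpr (Nat.pos_of_ne_zero hd)
  rw [SieveSequence.remainder, SieveSequence.shiftedPrimes_density, SieveSequence.shiftedPrimes_size,
    shiftedPrimesDensity_apply]
  by_cases hcop : d.Coprime h
  · rw [if_pos ⟨hcop, hd⟩, SieveSequence.shiftedPrimes_congrSum_eq]
    set u : (ZMod d)ˣ := ZMod.unitOfCoprime h hcop.symm with hu
    have hu' : ((u : ZMod d)) = (h : ZMod d) := ZMod.coe_unitOfCoprime h hcop.symm
    have e1 := abs_sub_le_primeAPError (x := N) hd hN1 le_rfl u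
    have e2 := abs_sub_le_primeAPError (x := N) hd hh1 hhN u
    rw [hu'] at e1 e2
    have e3 : |((⌊x⌋₊ : ℝ) - x) / Nat.totient d| ≤ 1 := by
      rw [abs_div, abs_of_pos (by linarith : (0 : ℝ) < Nat.totient d)]
      refine div_le_one_of_le₀ (abs_le.mpr ⟨?_, ?_⟩) (by linarith)
      · linarith [Nat.lt_floor_add_one x]
      · linarith [Nat.floor_le (by linarith : (0 : ℝ) ≤ x)]
    have hsplit : LevelOfDistribution.chebyshevPsiMod d (h : ZMod d) N - LevelOfDistribution.chebyshevPsiMod d (h : ZMod d) h -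
        ((Nat.totient d : ℝ))⁻¹ * x =
        (LevelOfDistribution.chebyshevPsiMod d (h : ZMod d) N - N / Nat.totient d) -
          (LevelOfDistribution.chebyshevPsiMod d (h : ZMod d) h - h / Nat.totient d) +
          ((⌊x⌋₊ : ℝ) - x) / Nat.totient d := by
      rw [hNeq]; ring
    rw [← hN, hsplit]
    calc _ ≤ |LevelOfDistribution.chebyshevPsiMod d (h : ZMod d) N - N / Nat.totient d| +
          |LevelOfDistribution.chebyshevPsiMod d (h : ZMod d) h - h / Nat.totient d| +
          |((⌊x⌋₊ : ℝ) - x) / Nat.totient d| :=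
          (abs_add_le _ _).trans (add_le_add (abs_sub _ _) le_rfl)
      _ ≤ _ := by linarith
  · rw [if_neg (fun h' => hcop h'.1), zero_mul, sub_zero]
    obtain ⟨p, hp, hpd, hph⟩ := Nat.Prime.not_coprime_iff_dvd.mp hcop
    have h0 : 0 ≤ (SieveSequence.shiftedPrimes h).congrSum d x :=
      Finset.sum_nonneg fun n _ => ArithmeticFunction.vonMangoldt_nonneg
    rw [abs_of_nonneg h0]
    linarith [shiftedPrimes_congrSum_le_log hh hp hpd hph x]

/-- Summed pointwise bound: for `x ≥ 2`, `N = ⌊x⌋ + h` and any exponent `γ`,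
`∑_{d ≤ x^γ, d squarefree} |R_d(x)| ≤ 2 ∑_{q ≤ N^γ} E*(N; q) + ⌊x^γ⌋ (1 + log N)` (Halberstam–Richert
Ch. 1, Example 5, made quantitative). [folklore] -/
theorem shiftedPrimes_sum_abs_remainder_le {h : ℕ} (hh : h ≠ 0) (γ : ℝ) (x : ℝ) (hx : 2 ≤ x) :
    ∑ d ∈ (Icc 1 ⌊x ^ γ⌋₊).filter Squarefree, |(SieveSequence.shiftedPrimes h).remainder d x| ≤
      2 * ∑ q ∈ Icc 1 ⌊((⌊x⌋₊ + h : ℕ) : ℝ) ^ γ⌋₊, primeAPError ((⌊x⌋₊ + h : ℕ) : ℝ) q +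
        (⌊x ^ γ⌋₊ : ℝ) * (1 + Real.log ((⌊x⌋₊ + h : ℕ) : ℝ)) := by
  set N : ℝ := ((⌊x⌋₊ + h : ℕ) : ℝ) with hN
  set D : ℕ := ⌊x ^ γ⌋₊ with hD
  have hxN : x ≤ N := by
    rw [hN]; push_cast
    have := Nat.lt_floor_add_one x
    have h1 : (1 : ℝ) ≤ h := by exact_mod_cast Nat.pos_of_ne_zero hh
    linarith
  have hsub : Icc 1 D ⊆ Icc 1 ⌊N ^ γ⌋₊ := by
    rcases le_or_gt 0 γ with hγ | hγ
    · exact Finset.Icc_subset_Icc le_rfl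
        (Nat.floor_le_floor (Real.rpow_le_rpow (by linarith) hxN hγ))
    · rw [hD, Nat.floor_eq_zero.mpr (Real.rpow_lt_one_of_one_lt_of_neg (by linarith) hγ)]
      simp
  calc ∑ d ∈ (Icc 1 D).filter Squarefree, |(SieveSequence.shiftedPrimes h).remainder d x|
      ≤ ∑ d ∈ (Icc 1 D).filter Squarefree, (2 * primeAPError N d + (1 + Real.log N)) := by
        refine Finset.sum_le_sum fun d hdS => ?_
        have hd1 : 1 ≤ d := (Finset.mem_Icc.mp (Finset.mem_filter.mp hdS).1).1
        exact shiftedPrimes_abs_remainder_le hh (by omega) x (by linarith)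
    _ = 2 * ∑ d ∈ (Icc 1 D).filter Squarefree, primeAPError N d +
          (#((Icc 1 D).filter Squarefree) : ℝ) * (1 + Real.log N) := by
        rw [Finset.sum_add_distrib, Finset.mul_sum, Finset.sum_const, nsmul_eq_mul]
    _ ≤ 2 * ∑ q ∈ Icc 1 ⌊N ^ γ⌋₊, primeAPError N q + (D : ℝ) * (1 + Real.log N) := by
        have hlog1 : 0 ≤ 1 + Real.log N := by
          have : 0 ≤ Real.log N := Real.log_nonneg (by linarith)
          linarith
        have hcard : (#((Icc 1 D).filter Squarefree) : ℝ) ≤ D :=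
          calc (#((Icc 1 D).filter Squarefree) : ℝ) ≤ #(Icc 1 D) := by
                exact_mod_cast Finset.card_le_card (Finset.filter_subset _ _)
            _ = D := by simp
        refine add_le_add (mul_le_mul_of_nonneg_left ?_ (by norm_num))
          (mul_le_mul_of_nonneg_right hcard hlog1)
        exact Finset.sum_le_sum_of_subset_of_nonneg ((Finset.filter_subset _ _).trans hsub)
            fun q _ _ => primeAPError_nonneg N q

/-- Auxiliary growth estimate: for `0 < ε` and any real `B`, eventually
`x^{1−ε} log x ≤ x / (log x)^B` (since `(log x)^{B+1} = o(x^ε)`, Mathlib's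
`isLittleO_log_rpow_rpow_atTop`). [folklore] -/
theorem rpow_mul_log_le_div_eventually {ε : ℝ} (hε : 0 < ε) (B : ℝ) :
    ∀ᶠ x : ℝ in atTop, x ^ (1 - ε) * Real.log x ≤ x / Real.log x ^ B := by
  filter_upwards [(isLittleO_log_rpow_rpow_atTop (B + 1) hε).eventuallyLE, eventually_gt_atTop 1]
    with x hx hx1
  have hx0 : 0 < x := by linarith
  have hlog : 0 < Real.log x := Real.log_pos hx1
  have hlB : 0 < Real.log x ^ B := Real.rpow_pos_of_pos hlog B
  rw [Real.norm_eq_abs, Real.norm_eq_abs, abs_of_nonneg (Real.rpow_nonneg hlog.le _),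
    abs_of_nonneg (Real.rpow_nonneg hx0.le _)] at hx
  rw [le_div_iff₀ hlB, mul_assoc, mul_comm (Real.log x), ← Real.rpow_add_one hlog.ne' B]
  calc x ^ (1 - ε) * Real.log x ^ (B + 1) ≤ x ^ (1 - ε) * x ^ ε :=
        mul_le_mul_of_nonneg_left hx (Real.rpow_nonneg hx0.le _)
    _ = x := by rw [← Real.rpow_add hx0]; simp

/-- **Discharge** of `hasLevelOfDistribution_shiftedPrimes_of_primesHaveLevel`: level of distribution
passes from the primes (`PrimesHaveLevel θ`) to the sifted sequence `shiftedPrimes h`, `h ≠ 0`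
(Halberstam–Richert, *Sieve Methods*, Ch. 1 Example 5 with Ch. 3 Thm 3.8). Proof: at
`N(x) = ⌊x⌋ + h → ∞`, `∑_{d ≤ x^{θ−ε}, μ²(d)=1} |R_d(x)| ≤ 2 ∑_{q ≤ N^{θ−ε}} E*(N; q) + x^{θ−ε}(1 + log N)`
(`shiftedPrimes_sum_abs_remainder_le`); the first term is `≪ N/log^B N ≤ (1+h) x/log^B x` by the
hypothesis composed with `N(x)`, the second is `≤ 3 x^{1−ε} log x ≤ 3x/log^B x` because `θ ≤ 1`
(`PrimesHaveLevel.le_one`). [cite: HalberstamRichert1974, Ch. 1 Example 5 and Thm. 3.8] -/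
theorem hasLevelOfDistribution_shiftedPrimes_of_primesHaveLevel_holds :
    hasLevelOfDistribution_shiftedPrimes_of_primesHaveLevel := by
  intro h hh θ hθ ε hε B hB
  have hθ1 : θ ≤ 1 := hθ.le_one
  simp only [SieveSequence.shiftedPrimes_size]
  -- the comparison point `N(x) = ⌊x⌋ + h`
  set N : ℝ → ℝ := fun x => ((⌊x⌋₊ + h : ℕ) : ℝ) with hN
  have hh1 : (1 : ℝ) ≤ h := by exact_mod_cast Nat.pos_of_ne_zero hh
  have hxN : ∀ x, x ≤ N x := fun x => by
    simp only [hN]; push_cast; linarith [Nat.lt_floor_add_one x]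
  have hNx : ∀ x, 1 ≤ x → N x ≤ (1 + h) * x := fun x hx => by
    simp only [hN]; push_cast
    nlinarith [Nat.floor_le (by linarith : (0 : ℝ) ≤ x)]
  have hNt : Tendsto N atTop atTop := tendsto_atTop_mono hxN tendsto_id
  -- (1) the Bombieri–Vinogradov-shape sum at `N(x)`
  have h1 : (fun x => ∑ q ∈ Icc 1 ⌊N x ^ (θ - ε)⌋₊, primeAPError (N x) q) =O[atTop]
      fun x => N x / Real.log (N x) ^ B :=
    (hθ B hB ε hε).comp_tendsto hNt
  have h2 : (fun x => N x / Real.log (N x) ^ B) =O[atTop] fun x => x / Real.log x ^ B := by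
    refine IsBigO.of_bound ((1 : ℝ) + h) ?_
    filter_upwards [eventually_gt_atTop 1] with x hx1
    have hx0 : 0 < x := by linarith
    have hlog : 0 < Real.log x := Real.log_pos hx1
    have hlB : 0 < Real.log x ^ B := Real.rpow_pos_of_pos hlog B
    have hlogN : Real.log x ≤ Real.log (N x) := Real.log_le_log hx0 (hxN x)
    have hN0 : 0 ≤ N x := hx0.le.trans (hxN x)
    rw [Real.norm_eq_abs, Real.norm_eq_abs, abs_of_nonneg (div_nonneg hx0.le hlB.le),
      abs_of_nonneg (div_nonneg hN0 (Real.rpow_nonneg (hlog.le.trans hlogN) _)), ← mul_div_assoc]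
    exact div_le_div₀ (by positivity) (hNx x hx1.le) hlB
      (Real.rpow_le_rpow hlog.le hlogN hB.le)
  -- (2) the trivial terms
  have h3 : (fun x => (⌊x ^ (θ - ε)⌋₊ : ℝ) * (1 + Real.log (N x))) =O[atTop]
      fun x => x / Real.log x ^ B := by
    refine IsBigO.of_bound 3 ?_
    filter_upwards [rpow_mul_log_le_div_eventually hε B, eventually_ge_atTop (1 + (h : ℝ)),
      eventually_ge_atTop (Real.exp 1), eventually_gt_atTop 1] with x hxB hxh hxe hx1
    have hx0 : 0 < x := by linarith
    have hlog : 0 < Real.log x := Real.log_pos hx1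
    have hlB : 0 < Real.log x ^ B := Real.rpow_pos_of_pos hlog B
    have hlog1 : 1 ≤ Real.log x := by
      rw [Real.le_log_iff_exp_le hx0]; exact hxe
    have hlogh : Real.log (1 + h) ≤ Real.log x := Real.log_le_log (by linarith) hxh
    have hlogN : Real.log (N x) ≤ Real.log (1 + h) + Real.log x := by
      rw [← Real.log_mul (by linarith) hx0.ne']
      exact Real.log_le_log (hx0.trans_le (hxN x)) (hNx x hx1.le)
    have hlogN0 : 0 ≤ Real.log (N x) := Real.log_nonneg (hx1.le.trans (hxN x))
    have hfl : (⌊x ^ (θ - ε)⌋₊ : ℝ) ≤ x ^ (1 - ε) :=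
      (Nat.floor_le (Real.rpow_nonneg hx0.le _)).trans
        (Real.rpow_le_rpow_of_exponent_le hx1.le (by linarith))
    rw [Real.norm_eq_abs, Real.norm_eq_abs, abs_of_nonneg (div_nonneg hx0.le hlB.le),
      abs_of_nonneg (mul_nonneg (Nat.cast_nonneg _) (by linarith))]
    calc (⌊x ^ (θ - ε)⌋₊ : ℝ) * (1 + Real.log (N x)) ≤ x ^ (1 - ε) * (3 * Real.log x) :=
          mul_le_mul hfl (by linarith) (by linarith) (Real.rpow_nonneg hx0.le _)
      _ = 3 * (x ^ (1 - ε) * Real.log x) := by ring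
      _ ≤ 3 * (x / Real.log x ^ B) := by linarith
  -- (3) assemble with the pointwise bound `shiftedPrimes_sum_abs_remainder_le`
  refine IsBigO.trans (IsBigO.of_bound 1 ?_) ((h1.trans h2).const_mul_left 2 |>.add h3)
  filter_upwards [eventually_ge_atTop 2] with x hx
  have hN1 : 1 ≤ N x := le_trans (by linarith) (hxN x)
  have key := shiftedPrimes_sum_abs_remainder_le hh (θ - ε) x hx
  rw [one_mul, Real.norm_eq_abs, abs_of_nonneg (Finset.sum_nonneg fun d _ => abs_nonneg _),
    Real.norm_eq_abs, abs_of_nonneg]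
  · exact key
  · exact add_nonneg
      (mul_nonneg (by norm_num) (Finset.sum_nonneg fun q _ => primeAPError_nonneg _ q))
      (mul_nonneg (Nat.cast_nonneg _) (by linarith [Real.log_nonneg hN1]))

end Literature.NumberTheory.Sieve
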